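import Summits.ResolutionOfSingularities.ResolutionOfSingularities.Theorems.FrobeniusClosingSteerInsepStepReadingMachineFour
import Summits.ResolutionOfSingularities.ResolutionOfSingularities.Theorems.FrobeniusClosingSteerInsepStepDerivations
import Summits.ResolutionOfSingularities.ResolutionOfSingularities.Theorems.FrobeniusClosingSteerInsepStepReadingsFour
import HarnessLib

/-!
# Steer / LEMMA I kernel, file F6: THE DEGREE-FOUR INSEPARABLE NEAR POINT — `F₁ − ψ² ∈ (X)²`

OURS (campaign res-hironaka, rung L ★L-G4, slot W4.1, crux `Steer` stmt-ResolutionOfSingularities-16345; res-L0-w41-plan-1 RULING 155a, kernel of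
res-L0-w41-idea-3's LEMMA I `InsepStepNotIsolated`, degree-FOUR near point `(1 : μ₁ : μ₂)` with `μ₁, μ₂` 2-independent (res-L0-w41-tri-1 v6.17);
res-L0-w41-stub-3 g7, blueprint `KERNEL-BLUEPRINT-LemmaI.md` 693d33707585fe97 §4 Case C; replaces the role of no printed item; NOT a statement of the
manuscript under review [claim: Hironaka2017, status: under-review]; AI review is weaker than expert review). Theses-free, definition-free.

**`exists_sub_sq_mem_sq_of_degFour`.** As in the degree-two file, but the near point has `t̄ ∉ κ₀` AND `z̄' ∉ κ₀ + κ₀ t̄`, with `t² − ℓ₁, z'² − ℓ₂ ∈ 𝔪₁`.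
THEN `F₁ − ψ² ∈ (X)²` for some `ψ`. Readings mod `(X)` in the TWO-dimensional regular `R̄ = S₁ ⧸ (X)` (rsop `q̄₁, q̄₂`) through the bivariate polynomial lemma
`LemmaI.polyLemma_two` (its auxiliary quotient is `S₁ ⧸ (X, q₂)`): (R-t), (R-z') kill the odd powers of `T` and of `Z'`, (R-u) makes every coefficient a
square mod `𝔪₀`, so `F₁ = ψ² + X·α` exactly; (R-E) reads `ᾱ ∈ 𝔫^{d−1}` and puts `α ∈ (X)`. [cite: Matsumura1987, Thm. 17.10, Thm. 30.6]
[cite: ZariskiSamuel1960, Ch. VIII §1 Thm. 1] [folklore]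
-/

noncomputable section

-- single-problem summit: the doubled namespace component `ResolutionOfSingularities` is forced
set_option linter.dupNamespace false

namespace Summit.ResolutionOfSingularities.ResolutionOfSingularities.Theorems.SwitchingDichotomy.LemmaI

open IsLocalRing MvPolynomial Literature.AlgebraicGeometry.Resolution
open Summit.ResolutionOfSingularities.ResolutionOfSingularities.Theorems.SwitchingDichotomy

variable {L : Type} [Field L] {S₀ S₁ : Subring L}

/-- **LEMMA I at a degree-four inseparable near point: `F₁ − ψ² ∈ (X)²`.** See the module docstring. OURS; replaces the role of no printed item; NOT a
statement of the manuscript under review. [cite: Matsumura1987, Thm. 17.10, Thm. 30.6] [cite: ZariskiSamuel1960, Ch. VIII §1 Thm. 1] [folklore] -/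
theorem exists_sub_sq_mem_sq_of_degFour [CharP L 2] [IsLocalRing S₀] [IsLocalRing S₁]
    (hreg₀ : IsRegularLocalRing S₀) (hreg₁ : IsRegularLocalRing S₁) (hdim₁ : ringKrullDim S₁ = 3)
    (hQT : IsQuadraticTransform S₀ S₁) (h : S₀ ≤ S₁)
    {X Y Z : S₀} (hXYZ : Ideal.span {X, Y, Z} = maximalIdeal S₀) (hX0 : (X : L) ≠ 0) (hB : blowupRing S₀ (X : L) ≤ S₁)
    (hfrac : ∀ w ∈ S₁, ∃ a ∈ blowupRing S₀ (X : L), ∃ b ∈ blowupRing S₀ (X : L), b⁻¹ ∈ S₁ ∧ w = a / b)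
    (t₁ z₁ : S₁) (ht₁ : (t₁ : L) = Y / X) (hz₁ : (z₁ : L) = Z / X)
    (ht : ∀ a : S₀, t₁ - Subring.inclusion h a ∉ maximalIdeal S₁)
    (hz : ∀ c e : S₀, z₁ - Subring.inclusion h c - Subring.inclusion h e * t₁ ∉ maximalIdeal S₁)
    (ℓ₁ ℓ₂ : S₀) (hq₁ : t₁ ^ 2 - Subring.inclusion h ℓ₁ ∈ maximalIdeal S₁) (hq₂ : z₁ ^ 2 - Subring.inclusion h ℓ₂ ∈ maximalIdeal S₁)
    {e : ℕ} (u : Fin e → S₀) (δ : Fin e → Derivation ℤ (ResidueField S₀) (ResidueField S₀))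
    (dx : Fin 3 → Derivation ℤ S₀ S₀) (du : Fin e → Derivation ℤ S₀ S₀)
    (hgen : Subfield.closure (Set.range (fun y : ResidueField S₀ => y ^ 2) ∪ Set.range (fun j => residue S₀ (u j))) = ⊤)
    (hδu : ∀ j j', δ j (residue S₀ (u j')) = if j' = j then 1 else 0)
    (hδker : ∀ y : ResidueField S₀, (∀ j, δ j y = 0) ↔ ∃ t, t ^ 2 = y)
    (hdx : ∀ i i', dx i (![X, Y, Z] i') = if i' = i then 1 else 0)
    (hdux : ∀ j i, du j (![X, Y, Z] i) = 0) (hduu : ∀ j j', du j (u j') = if j' = j then 1 else 0)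
    {d : ℕ} (hd : 4 ≤ d) {f : S₀} (hf : f ∈ maximalIdeal S₀ ^ d) {F₁ : S₁}
    (hF₁ : F₁ * Subring.inclusion h X ^ d = Subring.inclusion h f) (hord : ∃ g₁ : S₁, F₁ - g₁ ^ 2 ∈ maximalIdeal S₁ ^ d) :
    ∃ ψ : S₁, F₁ - ψ ^ 2 ∈ Ideal.span {Subring.inclusion h X} ^ 2 := by
  classical
  haveI := hreg₀
  haveI := hreg₁
  set ι := Subring.inclusion h with hι
  have hdom : SubringDominates S₀ S₁ := hQT.dominates
  obtain ⟨n, rfl⟩ : ∃ n, d = n + 1 := ⟨d - 1, by omega⟩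
  have hn3 : 3 ≤ n := by omega
  -- ### elements
  obtain ⟨hXm, hYm, hZm⟩ := mem_of_span_triple_eq hXYZ
  have hx0 : Ideal.span (Set.range ![X, Y, Z]) = maximalIdeal S₀ := by rw [span_range_vec3]; exact hXYZ
  have htX : t₁ * ι X = ι Y := div_mul_exc_eq h hX0 t₁ ht₁
  have hzX : z₁ * ι X = ι Z := div_mul_exc_eq h hX0 z₁ hz₁
  set q₁ : S₁ := t₁ ^ 2 - ι ℓ₁ with hq₁def
  set q₂ : S₁ := z₁ ^ 2 - ι ℓ₂ with hq₂def
  set I : Ideal S₁ := Ideal.span {ι X} with hI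
  have hXI : ι X ∈ I := Ideal.mem_span_singleton_self _
  have hmapm0 : (maximalIdeal S₀).map ι ≤ I := map_maximalIdeal_le_span_exc h hB hX0
  have hm0I : ∀ a ∈ maximalIdeal S₀, ι a ∈ I := fun a ha => hmapm0 (Ideal.mem_map_of_mem ι ha)
  have hm01 : ∀ a ∈ maximalIdeal S₀, ι a ∈ maximalIdeal S₁ := fun a ha => (inclusion_mem_maximalIdeal_iff hdom a).mpr ha
  have hXm₁ : ι X ∈ maximalIdeal S₁ := hm01 X hXm
  -- ### structure of `𝔪₁` and the reading machine (`read_of_degFour`)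
  have hm1 : maximalIdeal S₁ = Ideal.span {ι X, q₁, q₂} :=
    maximalIdeal_eq_span_triple_four hQT hdom hXYZ hX0 hB hfrac t₁ z₁ ht₁ hz₁ ht hz ℓ₁ ℓ₂ hq₁ hq₂
  have hx1 : Ideal.span (Set.range ![ι X, q₁, q₂]) = maximalIdeal S₁ := by rw [span_range_vec3]; exact hm1.symm
  have hIm : I ≤ maximalIdeal S₁ := by rw [hI, Ideal.span_le, Set.singleton_subset_iff]; exact hXm₁
  obtain ⟨hX2, read'⟩ := read_of_degFour hreg₁ hdim₁ hQT h hXYZ hX0 hB hfrac t₁ z₁ ht₁ hz₁ ht hz ℓ₁ ℓ₂ hq₁ hq₂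
  have read : ∀ {N : ℕ} {G : Polynomial (Polynomial S₀)}, (∀ j, (G.coeff j).degree < ((2 * N - j : ℕ) : WithBot ℕ)) →
      ∀ {a : S₁}, a ∈ maximalIdeal S₁ ^ N → G.eval₂ (Polynomial.eval₂RingHom ι z₁) t₁ - a ∈ I →
        ∀ j k, (G.coeff j).coeff k ∈ maximalIdeal S₀ := fun hdeg _ ha hcong => read' _ _ hdeg _ ha hcong

  -- ### the form `F` and the weak transform
  obtain ⟨F, hFhom, hFf⟩ := exists_form_eval_eq hXYZ hf
  have hF₁w : F₁ = eval₂ ι ![1, t₁, z₁] F := eq_eval₂_chart h hX0 t₁ z₁ htX hzX hFhom (by rw [hFf]; exact hF₁)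
  obtain ⟨g₁, hg₁⟩ := hord
  set hh : S₁ := F₁ - g₁ ^ 2 with hhdef
  have hF₁eq : F₁ = g₁ ^ 2 + hh := by rw [hhdef]; ring
  have hDF : ∀ D : Derivation ℤ S₁ S₁, D F₁ = D hh := fun D => by rw [hF₁eq, derivation_sq_add]
  -- ### the frame: tables of values
  have hd00 : dx 0 X = 1 := by simpa using hdx 0 0
  have hd01 : dx 0 Y = 0 := by simpa using hdx 0 1
  have hd02 : dx 0 Z = 0 := by simpa using hdx 0 2
  have hd10 : dx 1 X = 0 := by simpa using hdx 1 0
  have hd11 : dx 1 Y = 1 := by simpa using hdx 1 1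
  have hd12 : dx 1 Z = 0 := by simpa using hdx 1 2
  have hd20 : dx 2 X = 0 := by simpa using hdx 2 0
  have hd21 : dx 2 Y = 0 := by simpa using hdx 2 1
  have hd22 : dx 2 Z = 1 := by simpa using hdx 2 2
  have hduX : ∀ j, du j X = 0 := fun j => by simpa using hdux j 0
  have hduY : ∀ j, du j Y = 0 := fun j => by simpa using hdux j 1
  have hduZ : ∀ j, du j Z = 0 := fun j => by simpa using hdux j 2
  have eY_X : (X • dx 1) X = 0 := by rw [Derivation.smul_apply, smul_eq_mul, hd10, mul_zero]
  have eY_Y : (X • dx 1) Y = X := by rw [Derivation.smul_apply, smul_eq_mul, hd11, mul_one]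
  have eY_Z : (X • dx 1) Z = 0 := by rw [Derivation.smul_apply, smul_eq_mul, hd12, mul_zero]
  have eZ_X : (X • dx 2) X = 0 := by rw [Derivation.smul_apply, smul_eq_mul, hd20, mul_zero]
  have eZ_Y : (X • dx 2) Y = 0 := by rw [Derivation.smul_apply, smul_eq_mul, hd21, mul_zero]
  have eZ_Z : (X • dx 2) Z = X := by rw [Derivation.smul_apply, smul_eq_mul, hd22, mul_one]
  have hlogY : ∀ y ∈ maximalIdeal S₀, (X • dx 1) y ∈ maximalIdeal S₀ := fun y _ => by
    rw [Derivation.smul_apply, smul_eq_mul]; exact Ideal.mul_mem_right _ _ hXm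
  have hlogZ : ∀ y ∈ maximalIdeal S₀, (X • dx 2) y ∈ maximalIdeal S₀ := fun y _ => by
    rw [Derivation.smul_apply, smul_eq_mul]; exact Ideal.mul_mem_right _ _ hXm
  have hlogu : ∀ j, ∀ y ∈ maximalIdeal S₀, du j y ∈ maximalIdeal S₀ := fun j =>
    MemberDerivations.map_maximalIdeal_of_generators ![X, Y, Z] hx0 (du j) (fun i => by rw [hdux]; exact zero_mem _)
  set E : Derivation ℤ S₀ S₀ := X • dx 0 + Y • dx 1 + Z • dx 2 with hEdef
  have hEapp : ∀ y, E y = X * dx 0 y + Y * dx 1 y + Z * dx 2 y := fun y => by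
    simp only [hEdef, Derivation.add_apply, Derivation.smul_apply, smul_eq_mul]
  have hEX : E X = X := by rw [hEapp, hd00, hd10, hd20]; ring
  have hEY : E Y = Y := by rw [hEapp, hd01, hd11, hd21]; ring
  have hEZ : E Z = Z := by rw [hEapp, hd02, hd12, hd22]; ring
  have hEm : ∀ y, E y ∈ maximalIdeal S₀ := fun y => by
    rw [hEapp]
    exact Ideal.add_mem _ (Ideal.add_mem _ (Ideal.mul_mem_right _ _ hXm) (Ideal.mul_mem_right _ _ hYm))
      (Ideal.mul_mem_right _ _ hZm)
  -- ### extensions to `S₁` and their values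
  obtain ⟨Dt, hDt⟩ := exists_derivation_extend hQT h (X • dx 1) hlogY
  obtain ⟨Dz, hDz⟩ := exists_derivation_extend hQT h (X • dx 2) hlogZ
  have hDuex : ∀ j, ∃ Dj : Derivation ℤ S₁ S₁, ∀ a, Dj (ι a) = ι (du j a) := fun j =>
    exists_derivation_extend hQT h (du j) (hlogu j)
  choose Du hDu using hDuex
  obtain ⟨E₁, hE₁⟩ := exists_derivation_extend hQT h E (fun y _ => hEm y)
  have hDtt : Dt t₁ = 1 := by
    have := apply_chart_mul h _ Dt hDt htX
    rw [eY_Y, eY_X, map_zero, mul_zero, sub_zero] at this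
    exact eq_of_mul_eq_mul_exc h hX0 (by rw [this, one_mul])
  have hDtz : Dt z₁ = 0 := by
    have := apply_chart_mul h _ Dt hDt hzX
    rw [eY_Z, eY_X, map_zero, mul_zero, sub_zero] at this
    exact eq_of_mul_eq_mul_exc h hX0 (by rw [this, zero_mul])
  have hDzt : Dz t₁ = 0 := by
    have := apply_chart_mul h _ Dz hDz htX
    rw [eZ_Y, eZ_X, map_zero, mul_zero, sub_zero] at this
    exact eq_of_mul_eq_mul_exc h hX0 (by rw [this, zero_mul])
  have hDzz : Dz z₁ = 1 := by
    have := apply_chart_mul h _ Dz hDz hzX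
    rw [eZ_Z, eZ_X, map_zero, mul_zero, sub_zero] at this
    exact eq_of_mul_eq_mul_exc h hX0 (by rw [this, one_mul])
  have hDut : ∀ j, Du j t₁ = 0 := fun j => by
    have := apply_chart_mul h _ (Du j) (hDu j) htX
    rw [hduY, hduX, map_zero, mul_zero, sub_zero] at this
    exact eq_of_mul_eq_mul_exc h hX0 (by rw [this, zero_mul])
  have hDuz : ∀ j, Du j z₁ = 0 := fun j => by
    have := apply_chart_mul h _ (Du j) (hDu j) hzX
    rw [hduZ, hduX, map_zero, mul_zero, sub_zero] at this
    exact eq_of_mul_eq_mul_exc h hX0 (by rw [this, zero_mul])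
  have hE₁t : E₁ t₁ = 0 := by
    have := apply_chart_mul h _ E₁ hE₁ htX
    rw [hEY, hEX, ← htX, sub_self] at this
    exact eq_of_mul_eq_mul_exc h hX0 (by rw [this, zero_mul])
  have hE₁z : E₁ z₁ = 0 := by
    have := apply_chart_mul h _ E₁ hE₁ hzX
    rw [hEZ, hEX, ← hzX, sub_self] at this
    exact eq_of_mul_eq_mul_exc h hX0 (by rw [this, zero_mul])
  have hE₁X : E₁ (ι X) = ι X := by rw [hE₁, hEX]
  have hE₁S : ∀ w : S₁, E₁ w ∈ Ideal.span {ι X} :=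
    apply_mem_span_exc_of_euler h hXYZ hX0 hB hfrac t₁ z₁ ht₁ hz₁ E₁
      (fun a => by rw [hE₁]; exact inclusion_mem_span_exc h hB hX0 (hEm a)) hE₁t hE₁z
  -- logarithmic on `𝔪₁`
  have hlogDt : ∀ y ∈ maximalIdeal S₁, Dt y ∈ maximalIdeal S₁ := by
    refine MemberDerivations.map_maximalIdeal_of_generators ![ι X, q₁, q₂] hx1 Dt fun i => ?_
    fin_cases i
    · show Dt (ι X) ∈ maximalIdeal S₁
      rw [hDt, eY_X, map_zero]; exact zero_mem _
    · show Dt q₁ ∈ maximalIdeal S₁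
      rw [hq₁def, map_sub, derivation_sq, zero_sub, hDt, Derivation.smul_apply, smul_eq_mul]
      exact Submodule.neg_mem _ (hm01 _ (Ideal.mul_mem_right _ _ hXm))
    · show Dt q₂ ∈ maximalIdeal S₁
      rw [hq₂def, map_sub, derivation_sq, zero_sub, hDt, Derivation.smul_apply, smul_eq_mul]
      exact Submodule.neg_mem _ (hm01 _ (Ideal.mul_mem_right _ _ hXm))
  have hlogDz : ∀ y ∈ maximalIdeal S₁, Dz y ∈ maximalIdeal S₁ := by
    refine MemberDerivations.map_maximalIdeal_of_generators ![ι X, q₁, q₂] hx1 Dz fun i => ?_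
    fin_cases i
    · show Dz (ι X) ∈ maximalIdeal S₁
      rw [hDz, eZ_X, map_zero]; exact zero_mem _
    · show Dz q₁ ∈ maximalIdeal S₁
      rw [hq₁def, map_sub, derivation_sq, zero_sub, hDz, Derivation.smul_apply, smul_eq_mul]
      exact Submodule.neg_mem _ (hm01 _ (Ideal.mul_mem_right _ _ hXm))
    · show Dz q₂ ∈ maximalIdeal S₁
      rw [hq₂def, map_sub, derivation_sq, zero_sub, hDz, Derivation.smul_apply, smul_eq_mul]
      exact Submodule.neg_mem _ (hm01 _ (Ideal.mul_mem_right _ _ hXm))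
  have hlogE₁ : ∀ y ∈ maximalIdeal S₁, E₁ y ∈ maximalIdeal S₁ := fun y _ => hIm (hE₁S y)
  have hevFD : ∀ (δ₀ : Derivation ℤ S₀ S₀), (∀ y, δ₀ y ∈ maximalIdeal S₀) →
      eval₂ ι ![1, t₁, z₁] (∑ m ∈ F.support, monomial m (δ₀ (coeff m F))) ∈ I := fun δ₀ hδ₀ =>
    hmapm0 (mvPolynomial_eval₂_mem_map_of_forall_coeff_mem ι _ fun m => by
      rw [MemberDerivations.coeff_sum_monomial_derivation]; exact hδ₀ _)
  have hsmulm : ∀ (i : Fin 3) (y : S₀), (X • dx i) y ∈ maximalIdeal S₀ := fun i y => by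
    rw [Derivation.smul_apply, smul_eq_mul]; exact Ideal.mul_mem_right _ _ hXm
  set c : ℕ × ℕ → S₀ := fun p => F.coeff (Finsupp.single (0 : Fin 3) (n + 1 - p.1 - p.2) + Finsupp.single 1 p.1 + Finsupp.single 2 p.2)
    with hcdef
  -- ### (R-t): odd powers of `T`
  have hRt : ∀ j k, ((eval₂ (Polynomial.C.comp Polynomial.C) ![1, Polynomial.X, Polynomial.C Polynomial.X] (pderiv 1 F)).coeff j).coeff k ∈
      maximalIdeal S₀ := by
    refine read (N := n + 1) (degree_coeff_theta₂_lt (isHomogeneous_pderiv_of hFhom 1) (by omega))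
      (a := Dt hh) (apply_mem_pow_of_log Dt _ hlogDt (n + 1) hg₁) ?_
    rw [evalEval_theta₂, ← hDF, hF₁w, derivation_eval₂_chart h _ Dt hDt, hDtt, hDtz, mul_one, mul_zero, add_zero]
    have h2 := hevFD (X • dx 1) (hsmulm 1)
    rw [show eval₂ ι ![1, t₁, z₁] (pderiv 1 F) - (eval₂ ι ![1, t₁, z₁] (pderiv 1 F) +
        eval₂ ι ![1, t₁, z₁] (∑ m ∈ F.support, monomial m ((X • dx 1) (coeff m F)))) =
        -eval₂ ι ![1, t₁, z₁] (∑ m ∈ F.support, monomial m ((X • dx 1) (coeff m F))) by ring]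
    exact Submodule.neg_mem _ h2
  have hodd1 : ∀ p : ℕ × ℕ, ¬ Even p.1 → c p ∈ maximalIdeal S₀ := by
    rintro ⟨j, k⟩ hj
    rcases j with _ | j
    · exact absurd (show Even 0 from ⟨0, rfl⟩) hj
    have hje : Even j := by
      rcases Nat.even_or_odd j with h' | h'
      · exact h'
      · exact absurd (h'.add_odd odd_one) hj
    have hcast : ((j : S₀) + 1) = 1 := by
      rw [(CharP.cast_eq_zero_iff S₀ 2 j).mpr (even_iff_two_dvd.mp hje), zero_add]
    have := hRt j k
    rw [coeff_coeff_theta₂ (isHomogeneous_pderiv_of hFhom 1), coeff_pderiv, (layer₂_add_single n j k).1] at this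
    simp only [Finsupp.coe_add, Pi.add_apply, Finsupp.single_apply] at this
    simp only [hcdef]
    simpa [hcast] using this
  -- ### (R-z'): odd powers of `Z'`
  have hRz : ∀ j k, ((eval₂ (Polynomial.C.comp Polynomial.C) ![1, Polynomial.X, Polynomial.C Polynomial.X] (pderiv 2 F)).coeff j).coeff k ∈
      maximalIdeal S₀ := by
    refine read (N := n + 1) (degree_coeff_theta₂_lt (isHomogeneous_pderiv_of hFhom 2) (by omega))
      (a := Dz hh) (apply_mem_pow_of_log Dz _ hlogDz (n + 1) hg₁) ?_
    rw [evalEval_theta₂, ← hDF, hF₁w, derivation_eval₂_chart h _ Dz hDz, hDzt, hDzz, mul_one, mul_zero, zero_add]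
    have h2 := hevFD (X • dx 2) (hsmulm 2)
    rw [show eval₂ ι ![1, t₁, z₁] (pderiv 2 F) - (eval₂ ι ![1, t₁, z₁] (pderiv 2 F) +
        eval₂ ι ![1, t₁, z₁] (∑ m ∈ F.support, monomial m ((X • dx 2) (coeff m F)))) =
        -eval₂ ι ![1, t₁, z₁] (∑ m ∈ F.support, monomial m ((X • dx 2) (coeff m F))) by ring]
    exact Submodule.neg_mem _ h2
  have hodd2 : ∀ p : ℕ × ℕ, ¬ Even p.2 → c p ∈ maximalIdeal S₀ := by
    rintro ⟨j, k⟩ hk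
    rcases k with _ | k
    · exact absurd (show Even 0 from ⟨0, rfl⟩) hk
    have hke : Even k := by
      rcases Nat.even_or_odd k with h' | h'
      · exact h'
      · exact absurd (h'.add_odd odd_one) hk
    have hcast : ((k : S₀) + 1) = 1 := by
      rw [(CharP.cast_eq_zero_iff S₀ 2 k).mpr (even_iff_two_dvd.mp hke), zero_add]
    have := hRz j k
    rw [coeff_coeff_theta₂ (isHomogeneous_pderiv_of hFhom 2), coeff_pderiv, (layer₂_add_single n j k).2] at this
    simp only [Finsupp.coe_add, Pi.add_apply, Finsupp.single_apply] at this
    simp only [hcdef]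
    simpa [hcast] using this
  -- ### (R-u): every coefficient is a square mod `𝔪₀`
  have hRu : ∀ (j' : Fin e) (p : ℕ × ℕ), du j' (c p) ∈ maximalIdeal S₀ := by
    intro j' p
    have := read (N := n) (degree_coeff_theta₂_lt (isHomogeneous_derivCoeff (du j') hFhom) (by omega))
      (a := Du j' hh) (apply_mem_pow_of_mem_pow_succ (Du j') _ n hg₁) ?_ p.1 p.2
    · rwa [coeff_coeff_theta₂ (isHomogeneous_derivCoeff (du j') hFhom), MemberDerivations.coeff_sum_monomial_derivation] at this
    rw [evalEval_theta₂, ← hDF, hF₁w, derivation_eval₂_chart h _ (Du j') (hDu j'), hDut, hDuz, mul_zero, mul_zero, zero_add,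
      zero_add, sub_self]
    exact zero_mem _
  have hsq : ∀ p : ℕ × ℕ, ∃ s : S₀, c p - s ^ 2 ∈ maximalIdeal S₀ := fun p =>
    MemberDerivations.residue_kernelExact_of_dual_frame 2 u δ du hgen hδu hδker hlogu hduu _ (fun j' => hRu j' p)
  choose s hs using hsq
  set s' : ℕ × ℕ → S₀ := fun p => if Even p.1 ∧ Even p.2 then s p else 0 with hs'def
  have hs'odd : ∀ p, ¬ (Even p.1 ∧ Even p.2) → s' p = 0 := fun p hp => by simp [hs'def, hp]
  have hm : ∀ p, c p - s' p ^ 2 ∈ maximalIdeal S₀ := by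
    intro p
    by_cases hp : Even p.1 ∧ Even p.2
    · simp only [hs'def, hp, and_self, if_true]; exact hs p
    · simp only [hs'def, hp, if_false]
      rw [zero_pow two_ne_zero, sub_zero]
      rcases not_and_or.mp hp with h1 | h2
      · exact hodd1 p h1
      · exact hodd2 p h2
  have habc : ∀ p, ∃ a b c' : S₀, c p - s' p ^ 2 = a * X + b * Y + c' * Z := fun p =>
    exists_eq_of_mem_span_triple (hXYZ.symm ▸ hm p)
  choose a b c' habc using habc
  set T : Finset (ℕ × ℕ) := (Finset.range (n + 2) ×ˢ Finset.range (n + 2)).filter (fun p => p.1 + p.2 ≤ n + 1) with hT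
  have hTle : ∀ p ∈ T, p.1 + p.2 ≤ n + 1 := fun p hp => (Finset.mem_filter.mp hp).2
  set ψ₀ : S₁ := ∑ p ∈ T, ι (s' p) * z₁ ^ (p.2 / 2) * t₁ ^ (p.1 / 2) with hψ₀
  set α : S₁ := ∑ p ∈ T, (ι (a p) + ι (b p) * t₁ + ι (c' p) * z₁) * z₁ ^ p.2 * t₁ ^ p.1 with hα
  set GE : Polynomial (Polynomial S₀) := ∑ p ∈ T, (Polynomial.C (Polynomial.C (a p)) + Polynomial.C (Polynomial.C (b p)) * Polynomial.X +
      Polynomial.C (Polynomial.C (c' p) * Polynomial.X)) * Polynomial.C (Polynomial.X ^ p.2) * Polynomial.X ^ p.1 with hGE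
  -- ### `F₁` as a double sum over `T`
  have hczero : ∀ p : ℕ × ℕ, n + 1 < p.1 + p.2 → c p = 0 := by
    intro p hp
    simp only [hcdef]
    refine hFhom.coeff_eq_zero ?_
    rw [map_add, map_add, Finsupp.degree_single, Finsupp.degree_single, Finsupp.degree_single]
    omega
  set θF := eval₂ (Polynomial.C.comp Polynomial.C) ![1, Polynomial.X, Polynomial.C Polynomial.X] F with hθF
  have hθcoeff : ∀ j k, (θF.coeff j).coeff k = c (j, k) := fun j k => coeff_coeff_theta₂ hFhom j k
  have hinner : ∀ j, (θF.coeff j).natDegree < n + 2 := by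
    intro j
    refine Nat.lt_succ_of_le (Polynomial.natDegree_le_iff_coeff_eq_zero.mpr fun k hk => ?_)
    rw [hθcoeff]; exact hczero (j, k) (by simp only; omega)
  have houter : θF.natDegree < n + 2 := by
    refine Nat.lt_succ_of_le (Polynomial.natDegree_le_iff_coeff_eq_zero.mpr fun j hj => Polynomial.ext fun k => ?_)
    rw [hθcoeff, Polynomial.coeff_zero]; exact hczero (j, k) (by simp only; omega)
  have hF₁sum : F₁ = ∑ p ∈ T, ι (c p) * z₁ ^ p.2 * t₁ ^ p.1 := by
    rw [hF₁w, ← evalEval_theta₂ ι t₁ z₁ F, Polynomial.eval₂_eq_sum_range' _ houter]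
    have hrows : ∀ j ∈ Finset.range (n + 2), (Polynomial.eval₂RingHom ι z₁) (θF.coeff j) * t₁ ^ j =
        ∑ k ∈ Finset.range (n + 2), ι (c (j, k)) * z₁ ^ k * t₁ ^ j := by
      intro j _
      rw [Polynomial.coe_eval₂RingHom, Polynomial.eval₂_eq_sum_range' ι (hinner j), Finset.sum_mul]
      refine Finset.sum_congr rfl fun k _ => ?_
      rw [hθcoeff]
    rw [Finset.sum_congr rfl hrows, ← Finset.sum_product (s := Finset.range (n + 2)) (t := Finset.range (n + 2))
      (f := fun p : ℕ × ℕ => ι (c p) * z₁ ^ p.2 * t₁ ^ p.1), hT, Finset.sum_filter_of_ne]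
    intro p _ hne
    by_contra hgt
    exact hne (by rw [hczero p (by omega), map_zero, zero_mul, zero_mul])
  -- ### `F₁ = ψ₀² + X·α` with `α = EV G_E`
  have hXα : ∑ p ∈ T, ι (c p - s' p ^ 2) * z₁ ^ p.2 * t₁ ^ p.1 = ι X * α := by
    rw [hα, Finset.mul_sum]
    refine Finset.sum_congr rfl fun p _ => ?_
    rw [habc p, map_add, map_add, map_mul, map_mul, map_mul, ← htX, ← hzX]
    ring
  have hdecomp : F₁ - ψ₀ ^ 2 = ι X * α := by
    rw [hF₁sum, hψ₀, sum_sub_sq_sum_eq₂ ι t₁ z₁ T c s' hs'odd, hXα]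
  have hαGE : GE.eval₂ (Polynomial.eval₂RingHom ι z₁) t₁ = α := by rw [hGE, evalEval_GE]
  -- ### (R-E): `α ∈ (X)`
  obtain ⟨α', hα'⟩ := Ideal.mem_span_singleton'.mp (hE₁S α)
  have hEF₁ : E₁ F₁ = ι X * (α + α' * ι X) := by
    have h1 : F₁ = ψ₀ ^ 2 + ι X * α := by rw [← hdecomp]; ring
    rw [h1, derivation_sq_add, E₁.leibniz, smul_eq_mul, smul_eq_mul, hE₁X, ← hα']
    ring
  have hEF₁m : E₁ F₁ ∈ maximalIdeal S₁ ^ (n + 1) := by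
    rw [hDF]
    exact apply_mem_pow_of_log E₁ _ hlogE₁ (n + 1) hg₁
  have ha₀ : α + α' * ι X ∈ maximalIdeal S₁ ^ n := mem_pow_of_exc_mul_mem hX2 (by rw [← hEF₁]; exact hEF₁m)
  have hGEcoeff : ∀ j k, (GE.coeff j).coeff k ∈ maximalIdeal S₀ := by
    refine read (N := n) (degree_coeff_GE_lt T a b c' hTle (by omega)) (a := α + α' * ι X) ha₀ ?_
    rw [hαGE, show α - (α + α' * ι X) = -(α' * ι X) by ring]
    exact Submodule.neg_mem _ (Ideal.mul_mem_left _ _ hXI)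
  have hαI : α ∈ I := by
    rw [← hαGE]
    exact hmapm0 (evalEval_mem_map_of_forall_coeff_mem ι t₁ z₁ hGEcoeff)
  -- ### conclusion
  refine ⟨ψ₀, ?_⟩
  rw [hdecomp, pow_two]
  exact Ideal.mul_mem_mul hXI hαI

end Summit.ResolutionOfSingularities.ResolutionOfSingularities.Theorems.SwitchingDichotomy.LemmaI

end
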